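import Literature.MathematicalPhysics.QuantumLattice.DWaveSourceTorusJointExpansion
import HarnessLib

/-!
# The sourced pressure of the Hubbard torus at fixed temperature: joint expansion and decoupling of `U` and `h`

Topic `MathematicalPhysics/QuantumLattice`; consequences of
`DWaveSourceTorusJointExpansion.dWaveSourceTorus_partitionFn_eq_exp_doubleSeries` for the real finite-volume
pressure `log Z_L(β; U, μ, h)` of the `d`-wave–sourced Hubbard torus. For `β ≥ 0`, `μ` there are `δ > 0`,
`K ≥ 0` such that for all `L ≥ 3` and real `|U|, |h| ≤ δ`:

* `log Re Z_L(U,h) = βμL² + log Re Z₀(L) + Re Σ_{j≥1} c_j(L; U, h)` with `Σ_j ‖c_j‖ < ∞`: the pressure is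
  the free Nambu pressure plus a convergent sum of homogeneous polynomials in `(U, h)`, uniformly in `L`;
* `|log Z_L(U,h) - log Z_L(U,0) - log Z_L(0,h) + log Z_L(0,0)| ≤ K L² |U| |h|`: at fixed temperature the
  interaction changes the response of the pressure to the pair source by at most `O(|U||h|)·L²`,
  uniformly in the volume — the words carrying at least one interaction letter AND at least one source
  letter (`dWaveSourceTorus_log_partitionFn_jointExpansion`). The route ThermalWedge's cruxes ask for such a
  decoupling on the window `β ≤ e^{a/U}` with `(1 + log β)`-growth of the constants: the multiscale
  extension of this single-scale statement.

Everything is PROVED; no definition and no named fact.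

## References
* G. Benfatto, A. Giuliani, V. Mastropietro, Ann. Henri Poincaré 7 (2006) 809–898, §2, (2.77).
  [cite: BenfattoGiulianiMastropietro2006, (2.77)]
* D. Ruelle, *Statistical Mechanics: Rigorous Results* (1969), §4.4. [cite: Ruelle1969, §4.4]
-/

noncomputable section

open scoped Matrix.Norms.L2Operator ComplexOrder
open Finset MeasureTheory Filter Topology NormedSpace Set
open Literature.Probability.LatticeModels

namespace Literature.MathematicalPhysics.QuantumLattice

-- the generic `DecidableEq` path on `Orb (FermionTorus 2 L)` (cf. `ShibaFreeThermalKernel`)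
attribute [-instance] instDecidableEqLex

/-! ### Real logarithms of products `c · e^F` of positive reals; two elementary bounds -/

section RealLog

/-- A positive real complex number has real part equal to its norm. [folklore] -/
theorem re_eq_norm_of_pos {z : ℂ} (hz : 0 < z) : z.re = ‖z‖ := by
  obtain ⟨hre, him⟩ := Complex.pos_iff.mp hz
  have hzz : z = ((z.re : ℝ) : ℂ) := Complex.ext (by simp) (by simp [← him])
  conv_rhs => rw [hzz, Complex.norm_real, Real.norm_eq_abs, abs_of_pos hre]

/-- **`log` of `Z = c · e^F` for positive reals `Z, c`**: `log Re Z = log Re c + Re F`. [folklore] -/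
theorem log_re_eq_of_eq_mul_exp {Z c F : ℂ} (hZ : 0 < Z) (hc : 0 < c) (h : Z = c * Complex.exp F) :
    Real.log Z.re = Real.log c.re + F.re := by
  have hcpos : 0 < c.re := (Complex.pos_iff.mp hc).1
  rw [re_eq_norm_of_pos hZ, h, norm_mul, Complex.norm_exp, ← re_eq_norm_of_pos hc,
    Real.log_mul hcpos.ne' (Real.exp_pos _).ne', Real.log_exp]

/-- `(j+1) 3^{-j} ≤ (2/3)^j`. [folklore] -/
theorem succ_mul_third_pow_le (j : ℕ) : ((j : ℝ) + 1) * (1 / 3) ^ j ≤ (2 / 3) ^ j := by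
  have h1 : (j : ℝ) + 1 ≤ 2 ^ j := by exact_mod_cast Nat.lt_two_pow_self
  calc ((j : ℝ) + 1) * (1 / 3) ^ j ≤ 2 ^ j * (1 / 3) ^ j :=
        mul_le_mul_of_nonneg_right h1 (by positivity)
    _ = (2 / 3) ^ j := by rw [← mul_pow]; norm_num

/-- **The mixed increments of the monomials**: for `j ≥ 1`, `m ≤ j` and `|U|, |h| ≤ δ`,
`‖U^{j-m}h^m - U^{j-m}0^m - 0^{j-m}h^m + 0^{j-m}0^m‖ ≤ |U| |h| δ^{j-2}` (it vanishes for `m ∈ {0, j}` and is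
`U^{j-m}h^m` otherwise). [folklore] -/
theorem norm_mixed_monomial_le {U h δ : ℝ} (hU : |U| ≤ δ) (hh : |h| ≤ δ) {j m : ℕ} (hj : 1 ≤ j) (hm : m ≤ j) :
    ‖(U : ℂ) ^ (j - m) * (h : ℂ) ^ m - (U : ℂ) ^ (j - m) * (0 : ℂ) ^ m -
        (0 : ℂ) ^ (j - m) * (h : ℂ) ^ m + (0 : ℂ) ^ (j - m) * (0 : ℂ) ^ m‖ ≤ |U| * |h| * δ ^ (j - 2) := by
  have hδ0 : 0 ≤ δ := (abs_nonneg U).trans hU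
  have hRHS : 0 ≤ |U| * |h| * δ ^ (j - 2) := by positivity
  rcases Nat.eq_zero_or_pos m with rfl | hm0
  · -- `m = 0`
    have hj0 : j - 0 ≠ 0 := by omega
    simp only [pow_zero, mul_one, zero_pow hj0, sub_self, zero_add, norm_zero]
    exact hRHS
  rcases eq_or_lt_of_le hm with rfl | hmj
  · -- `m = j`
    have hm0' : m ≠ 0 := by omega
    simp only [Nat.sub_self, pow_zero, one_mul, zero_pow hm0', mul_zero, sub_zero, sub_self, zero_add,
      norm_zero]
    exact hRHS
  · -- `1 ≤ m ≤ j - 1`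
    have hm0' : m ≠ 0 := by omega
    have hjm : j - m ≠ 0 := by omega
    simp only [zero_pow hm0', zero_pow hjm, mul_zero, zero_mul, sub_zero, add_zero, norm_mul, norm_pow,
      Complex.norm_real, Real.norm_eq_abs]
    have hpU : |U| ^ (j - m) = |U| ^ (j - m - 1) * |U| := by
      rw [← pow_succ]; congr 1; omega
    have hph : |h| ^ m = |h| ^ (m - 1) * |h| := by
      rw [← pow_succ]; congr 1; omega
    have hpδ : δ ^ (j - 2) = δ ^ (j - m - 1) * δ ^ (m - 1) := by
      rw [← pow_add]; congr 1; omega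
    rw [hpU, hph, hpδ]
    have hUp : |U| ^ (j - m - 1) ≤ δ ^ (j - m - 1) := pow_le_pow_left₀ (abs_nonneg _) hU _
    have hhp : |h| ^ (m - 1) ≤ δ ^ (m - 1) := pow_le_pow_left₀ (abs_nonneg _) hh _
    calc |U| ^ (j - m - 1) * |U| * (|h| ^ (m - 1) * |h|)
        = (|U| * |h|) * (|U| ^ (j - m - 1) * |h| ^ (m - 1)) := by ring
      _ ≤ (|U| * |h|) * (δ ^ (j - m - 1) * δ ^ (m - 1)) :=
          mul_le_mul_of_nonneg_left (mul_le_mul hUp hhp (by positivity) (by positivity)) (by positivity)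
      _ = |U| * |h| * (δ ^ (j - m - 1) * δ ^ (m - 1)) := by ring

end RealLog

/-! ### The pressure -/

section Pressure

variable (β μ : ℝ)

/-- **The sourced pressure as a convergent sum of homogeneous polynomials in `(U, h)` (fixed `β`),
and the decoupling of interaction and source.** For `β ≥ 0`, `μ` there are `δ > 0` and `K ≥ 0` such that
for all `L ≥ 3` and real `U, h` with `|U| ≤ δ`, `|h| ≤ δ`, with `𝓚₀ = shibaOneBody τ_L Δ_{L,0} μ 0` and the
connected coefficients `c_j(L;U,h)` of `DWaveSourceTorusJointExpansion`: (i) `Σ_j ‖c_j‖ < ∞` and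
`log Re Z_L(β; U, μ, h) = βμL² + log Re Z₀(L) + Re Σ_{j ≥ 1} c_j(L; U, h)`; (ii)
`|log Z_L(U,h) - log Z_L(U,0) - log Z_L(0,h) + log Z_L(0,0)| ≤ K L² |U| |h|`.
[cite: BenfattoGiulianiMastropietro2006, (2.77)] -/
theorem dWaveSourceTorus_log_partitionFn_jointExpansion (hβ : 0 ≤ β) :
    ∃ δ : ℝ, 0 < δ ∧ ∃ K : ℝ, 0 ≤ K ∧ ∀ (L : ℕ) [NeZero L], 3 ≤ L →
      ∀ U h : ℝ, |U| ≤ δ → |h| ≤ δ →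
        (Summable fun j : ℕ => ‖(if j = 0 then (0 : ℂ) else orderedIntegral j (wordUrsellIntegrand β
            (shibaOneBody (dwsHopping L) (dwsPairing L 0) μ ((0 : ℝ) : ℂ))
            (dwsOp L) (dwsOm L) (dwsWeight L U h) j) 1)‖) ∧
        Real.log (Matrix.partitionFn β (dWaveSourceTorus L U μ h)).re =
          β * (μ * (L : ℝ) ^ 2) +
            Real.log (Matrix.partitionFn β
              (dGamma (shibaOneBody (dwsHopping L) (dwsPairing L 0) μ ((0 : ℝ) : ℂ)))).re +
            (∑' j : ℕ, (if j = 0 then (0 : ℂ) else orderedIntegral j (wordUrsellIntegrand β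
              (shibaOneBody (dwsHopping L) (dwsPairing L 0) μ ((0 : ℝ) : ℂ))
              (dwsOp L) (dwsOm L) (dwsWeight L U h) j) 1)).re ∧
        |Real.log (Matrix.partitionFn β (dWaveSourceTorus L U μ h)).re -
            Real.log (Matrix.partitionFn β (dWaveSourceTorus L U μ 0)).re -
            Real.log (Matrix.partitionFn β (dWaveSourceTorus L 0 μ h)).re +
            Real.log (Matrix.partitionFn β (dWaveSourceTorus L 0 μ 0)).re| ≤
          K * (L : ℝ) ^ 2 * |U| * |h| := by
  classical
  obtain ⟨δ, hδ, ϱ, hϱ, hϱδ, A, hA, hmain⟩ := dWaveSourceTorus_partitionFn_eq_exp_doubleSeries β μ hβ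
  refine ⟨δ, hδ, 27 * A * ϱ ^ 2, by positivity, ?_⟩
  intro L _ hL U h hU hh
  obtain ⟨hC, hUh⟩ := hmain L hL
  haveI : Nonempty (Finset (Orb (FermionTorus 2 L))) := ⟨∅⟩
  -- abbreviations: the free operator, the connected coefficients, the restricted coefficients
  set K0 := shibaOneBody (dwsHopping L) (dwsPairing L 0) μ ((0 : ℝ) : ℂ) with hK0
  have hK0h : K0.IsHermitian := by
    refine isHermitian_shibaOneBody (fun x y => ?_) _ μ 0
    simp only [dwsHopping, apply_ite star, star_neg, star_one, star_zero, (fermionTorusGraph 2 L).adj_comm x y]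
  set c : ℝ → ℝ → ℕ → ℂ := fun U' h' j => if j = 0 then (0 : ℂ) else orderedIntegral j
    (wordUrsellIntegrand β K0 (dwsOp L) (dwsOm L) (dwsWeight L U' h') j) 1 with hc
  set Cf : ℕ → ℕ → ℂ := fun j m => orderedIntegral j (fun u : Fin j → ℝ => (-(β : ℂ)) ^ j *
      ∑ g ∈ univ.filter (fun g : Fin j → DwsType × FermionTorus 2 L =>
          (univ.filter fun i => Sum.isRight (g i).1).card = m),
        (∏ i, dwsWeight L 1 1 (g i)) *
          ursellOf (FermionicTree.moment (wordCluster 2 j)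
            (wordPropMatrix β K0 (dwsOp L) (dwsOm L) g (fun i => ((u i : ℝ) : ℂ) * -(β : ℂ)))) univ) 1
    with hCf
  have hCfb : ∀ j m : ℕ, 1 ≤ j → ‖Cf j m‖ ≤ (L : ℝ) ^ 2 * A * ϱ ^ j := fun j m hj => hC j m hj
  -- the data at the four corners `(U,h), (U,0), (0,h), (0,0)`
  have h0δ : |(0 : ℝ)| ≤ δ := by rw [abs_zero]; exact hδ.le
  have corner : ∀ U' h' : ℝ, |U'| ≤ δ → |h'| ≤ δ →
      (∀ j : ℕ, 1 ≤ j → c U' h' j = ∑ m ∈ Finset.range (j + 1),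
        Cf j m * (U' : ℂ) ^ (j - m) * (h' : ℂ) ^ m) ∧
      (Summable fun j : ℕ => ‖c U' h' j‖) ∧
      Real.log (Matrix.partitionFn β (dWaveSourceTorus L U' μ h')).re =
        β * (μ * (L : ℝ) ^ 2) + Real.log (Matrix.partitionFn β (dGamma K0)).re + (∑' j : ℕ, c U' h' j).re := by
    intro U' h' hU' hh'
    obtain ⟨hrep, hcj, hZ⟩ := hUh U' h' hU' hh'
    have hrep' : ∀ j : ℕ, 1 ≤ j → c U' h' j = ∑ m ∈ Finset.range (j + 1),
        Cf j m * (U' : ℂ) ^ (j - m) * (h' : ℂ) ^ m := by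
      intro j hj
      simp only [hc, if_neg (Nat.one_le_iff_ne_zero.mp hj)]
      exact hrep j
    have hcb : ∀ j : ℕ, 1 ≤ j → ‖c U' h' j‖ ≤ (L : ℝ) ^ 2 * A * (2 / 3) ^ j := by
      intro j hj
      simp only [hc, if_neg (Nat.one_le_iff_ne_zero.mp hj)]
      calc _ ≤ (L : ℝ) ^ 2 * A * ((j : ℝ) + 1) * (1 / 3) ^ j := hcj j hj
        _ = (L : ℝ) ^ 2 * A * (((j : ℝ) + 1) * (1 / 3) ^ j) := by ring
        _ ≤ (L : ℝ) ^ 2 * A * (2 / 3) ^ j :=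
            mul_le_mul_of_nonneg_left (succ_mul_third_pow_le j) (by positivity)
    have hsum : Summable fun j : ℕ => ‖c U' h' j‖ := by
      refine Summable.of_nonneg_of_le (fun j => norm_nonneg _) (fun j => ?_)
        ((summable_geometric_of_lt_one (by norm_num) (by norm_num : (2 / 3 : ℝ) < 1)).mul_left
          ((L : ℝ) ^ 2 * A))
      by_cases hj0 : j = 0
      · subst hj0; simp only [hc, if_true, norm_zero]; positivity
      · exact hcb j (Nat.one_le_iff_ne_zero.mpr hj0)
    refine ⟨hrep', hsum, ?_⟩
    have hZpos : 0 < Matrix.partitionFn β (dWaveSourceTorus L U' μ h') :=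
      Matrix.partitionFn_pos β (dWaveSourceTorus_isHermitian L (isHermitian_hamiltonianWith (fermionTorusGraph 2 L) 1 U' μ) h')
    have hZ0pos : 0 < Matrix.partitionFn β (dGamma K0) := Matrix.partitionFn_pos β (isHermitian_dGamma hK0h)
    have hexp : (0 : ℂ) < (Real.exp (β * (μ * (L : ℝ) ^ 2)) : ℂ) := by exact_mod_cast Real.exp_pos _
    have hcpos : 0 < (Real.exp (β * (μ * (L : ℝ) ^ 2)) : ℂ) * Matrix.partitionFn β (dGamma K0) :=
      mul_pos hexp hZ0pos
    have key := log_re_eq_of_eq_mul_exp hZpos hcpos hZ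
    rw [key, Complex.re_ofReal_mul, Real.log_mul (Real.exp_pos _).ne' (Complex.pos_iff.mp hZ0pos).1.ne',
      Real.log_exp]
  obtain ⟨hrepUh, hsumUh, hlogUh⟩ := corner U h hU hh
  obtain ⟨hrepU0, hsumU0, hlogU0⟩ := corner U 0 hU h0δ
  obtain ⟨hrep0h, hsum0h, hlog0h⟩ := corner 0 h h0δ hh
  obtain ⟨hrep00, hsum00, hlog00⟩ := corner 0 0 h0δ h0δ
  refine ⟨hsumUh, hlogUh, ?_⟩
  -- (ii) the mixed increment: only words with an interaction AND a source letter survive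
  set mx : ℕ → ℂ := fun j => c U h j - c U 0 j - c 0 h j + c 0 0 j with hmx
  have hmx_eq : ∀ j : ℕ, 1 ≤ j → mx j = ∑ m ∈ Finset.range (j + 1), Cf j m *
      ((U : ℂ) ^ (j - m) * (h : ℂ) ^ m - (U : ℂ) ^ (j - m) * (0 : ℂ) ^ m -
        (0 : ℂ) ^ (j - m) * (h : ℂ) ^ m + (0 : ℂ) ^ (j - m) * (0 : ℂ) ^ m) := by
    intro j hj
    simp only [hmx, hrepUh j hj, hrepU0 j hj, hrep0h j hj, hrep00 j hj, Complex.ofReal_zero]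
    rw [← Finset.sum_sub_distrib, ← Finset.sum_sub_distrib, ← Finset.sum_add_distrib]
    refine Finset.sum_congr rfl fun m _ => ?_
    ring
  have hmx_le : ∀ j : ℕ, ‖mx j‖ ≤ 9 * ((L : ℝ) ^ 2 * A * ϱ ^ 2 * |U| * |h|) * (2 / 3) ^ j := by
    intro j
    have hnn : 0 ≤ 9 * ((L : ℝ) ^ 2 * A * ϱ ^ 2 * |U| * |h|) * (2 / 3) ^ j := by positivity
    rcases Nat.lt_or_ge j 2 with hj2 | hj2
    · -- `j = 0`: all four vanish; `j = 1`: the monomial increments vanish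
      interval_cases j
      · simp only [hmx, hc, if_true, sub_self, add_zero, norm_zero]; exact hnn
      · rw [hmx_eq 1 le_rfl]
        refine (norm_sum_le _ _).trans ?_
        refine (Finset.sum_le_sum (g := fun _ => (0 : ℝ)) fun m hm => ?_).trans
          (by rw [Finset.sum_const_zero]; exact hnn)
        have hm1 : m ≤ 1 := Nat.lt_succ_iff.mp (Finset.mem_range.mp hm)
        rw [norm_mul]
        have := norm_mixed_monomial_le hU hh (le_refl 1) hm1
        interval_cases m <;> simp
    · have hj1 : 1 ≤ j := by omega
      rw [hmx_eq j hj1]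
      refine (norm_sum_le _ _).trans ?_
      have hterm : ∀ m ∈ Finset.range (j + 1), ‖Cf j m * ((U : ℂ) ^ (j - m) * (h : ℂ) ^ m -
          (U : ℂ) ^ (j - m) * (0 : ℂ) ^ m - (0 : ℂ) ^ (j - m) * (h : ℂ) ^ m + (0 : ℂ) ^ (j - m) * (0 : ℂ) ^ m)‖ ≤
          (L : ℝ) ^ 2 * A * ϱ ^ j * (|U| * |h| * δ ^ (j - 2)) := by
        intro m hm
        have hmj : m ≤ j := Nat.lt_succ_iff.mp (Finset.mem_range.mp hm)
        rw [norm_mul]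
        exact mul_le_mul (hCfb j m hj1) (norm_mixed_monomial_le hU hh hj1 hmj) (norm_nonneg _) (by positivity)
      refine (Finset.sum_le_sum hterm).trans ?_
      rw [Finset.sum_const, Finset.card_range, nsmul_eq_mul]
      -- `(j+1) ϱ^j δ^{j-2} ≤ 9 ϱ² (j+1) 3^{-j} ≤ 9 ϱ² (2/3)^j`
      have hϱδ' : (ϱ * δ) ^ (j - 2) ≤ (1 / 3) ^ (j - 2) := pow_le_pow_left₀ (by positivity) hϱδ _
      have hpow : ϱ ^ j * δ ^ (j - 2) ≤ 9 * ϱ ^ 2 * (1 / 3) ^ j := by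
        have e1 : ϱ ^ j = ϱ ^ 2 * ϱ ^ (j - 2) := by rw [← pow_add]; congr 1; omega
        have e2 : (1 / 3 : ℝ) ^ (j - 2) = 9 * (1 / 3) ^ j := by
          have : j = (j - 2) + 2 := by omega
          conv_rhs => rw [this, pow_add]
          norm_num
          ring
        calc ϱ ^ j * δ ^ (j - 2) = ϱ ^ 2 * (ϱ * δ) ^ (j - 2) := by rw [e1, mul_pow]; ring
          _ ≤ ϱ ^ 2 * (1 / 3) ^ (j - 2) := mul_le_mul_of_nonneg_left hϱδ' (by positivity)
          _ = 9 * ϱ ^ 2 * (1 / 3) ^ j := by rw [e2]; ring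
      have hsucc := succ_mul_third_pow_le j
      calc ((j + 1 : ℕ) : ℝ) * ((L : ℝ) ^ 2 * A * ϱ ^ j * (|U| * |h| * δ ^ (j - 2)))
          = ((L : ℝ) ^ 2 * A * |U| * |h|) * (((j : ℝ) + 1) * (ϱ ^ j * δ ^ (j - 2))) := by push_cast; ring
        _ ≤ ((L : ℝ) ^ 2 * A * |U| * |h|) * (((j : ℝ) + 1) * (9 * ϱ ^ 2 * (1 / 3) ^ j)) := by
            refine mul_le_mul_of_nonneg_left (mul_le_mul_of_nonneg_left hpow (by positivity)) (by positivity)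
        _ = 9 * ((L : ℝ) ^ 2 * A * ϱ ^ 2 * |U| * |h|) * (((j : ℝ) + 1) * (1 / 3) ^ j) := by ring
        _ ≤ 9 * ((L : ℝ) ^ 2 * A * ϱ ^ 2 * |U| * |h|) * (2 / 3) ^ j :=
            mul_le_mul_of_nonneg_left hsucc (by positivity)
  -- summing up
  have hsmx : Summable fun j : ℕ => ‖mx j‖ :=
    Summable.of_nonneg_of_le (fun j => norm_nonneg _) hmx_le
      ((summable_geometric_of_lt_one (by norm_num) (by norm_num : (2 / 3 : ℝ) < 1)).mul_left _)
  have htsum : (∑' j : ℕ, c U h j) - (∑' j : ℕ, c U 0 j) - (∑' j : ℕ, c 0 h j) + (∑' j : ℕ, c 0 0 j) =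
      ∑' j : ℕ, mx j := by
    rw [← (Summable.of_norm hsumUh).tsum_sub (Summable.of_norm hsumU0),
      ← ((Summable.of_norm hsumUh).sub (Summable.of_norm hsumU0)).tsum_sub (Summable.of_norm hsum0h),
      ← (((Summable.of_norm hsumUh).sub (Summable.of_norm hsumU0)).sub (Summable.of_norm hsum0h)).tsum_add
        (Summable.of_norm hsum00)]
  have hreal : Real.log (Matrix.partitionFn β (dWaveSourceTorus L U μ h)).re -
      Real.log (Matrix.partitionFn β (dWaveSourceTorus L U μ 0)).re -
      Real.log (Matrix.partitionFn β (dWaveSourceTorus L 0 μ h)).re +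
      Real.log (Matrix.partitionFn β (dWaveSourceTorus L 0 μ 0)).re = (∑' j : ℕ, mx j).re := by
    rw [hlogUh, hlogU0, hlog0h, hlog00, ← htsum]
    simp only [Complex.sub_re, Complex.add_re]
    ring
  rw [hreal]
  calc |(∑' j : ℕ, mx j).re| ≤ ‖∑' j : ℕ, mx j‖ := Complex.abs_re_le_norm _
    _ ≤ ∑' j : ℕ, ‖mx j‖ := norm_tsum_le_tsum_norm hsmx
    _ ≤ ∑' j : ℕ, 9 * ((L : ℝ) ^ 2 * A * ϱ ^ 2 * |U| * |h|) * (2 / 3) ^ j :=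
        Summable.tsum_le_tsum hmx_le hsmx
          ((summable_geometric_of_lt_one (by norm_num) (by norm_num : (2 / 3 : ℝ) < 1)).mul_left _)
    _ = 9 * ((L : ℝ) ^ 2 * A * ϱ ^ 2 * |U| * |h|) * ∑' j : ℕ, (2 / 3 : ℝ) ^ j := tsum_mul_left
    _ = 27 * A * ϱ ^ 2 * (L : ℝ) ^ 2 * |U| * |h| := by
        rw [tsum_geometric_of_lt_one (by norm_num) (by norm_num : (2 / 3 : ℝ) < 1)]
        norm_num
        ring

end Pressure

end Literature.MathematicalPhysics.QuantumLattice
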